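import Summits.CriticalPhenomena.PercolationContinuityZ3.Theorems.PercNearOneGluingNoHeavyLowerTailSahiCombTriWAssign

/-!
# The SANDWICH CRITERION for `TRI_W(a)`: the master functional as `Σ_x [U_P(F x, G x) − L_P(F xᶜ, G x)]`, and pair-local certificates
# as bilinear forms squeezed between the two explicit forms `L_P ≤ U_P` on pairs of up-sets

Support file of the one-cut programme (crux `NoHeavyLowerTail`, stmt-CriticalPhenomena-4575; cell `prim-masterthm`, seat P5 gen 24;
memo `FROM-prim-masterthm-p5-g24-SANDWICH.md`).  Continuation of `…SahiCombTriWPairLocal` (pair-local principle), `…SahiCombTriWPairLocalLit`,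
`…SahiCombTriWAssign` (LIFT criterion).  Target of the lane: `FiveUpSet.TriWIneq` (`…SahiCombTriWGeneral`, OPEN for `a ≥ 2` in general).

For a test family `P` and families `A, B` of the fibre cube `W = Finset γ` put (`refl` = antipodal image)

  `U_P(A,B) = 2·#(P ∩ A ∩ B) − #(refl P ∩ A ∩ B)`                       (`FiveUpSet.uForm`),
  `L_P(A,B) = #(P ∩ refl A ∩ B) + #(P ∩ A ∩ refl B) − #(refl P ∩ A ∩ B)`   (`FiveUpSet.lForm`),

so that `U_P − L_P = Kl_{P∩B}(A) + Kl'_{P∩A}(B) ≥ 0` for up-sets (`uForm_sub_lForm`, the two relative Kleitman gaps of `…TriWAssign`).  Then: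

1. **Master identity** (`FiveUpSet.triW_eq_sum_uForm_sub_lForm`, no hypothesis on `P, F, G`):
   `triW P F G = Σ_{x : Finset β} [U_P(F x, G x) − L_P(F xᶜ, G x)]`;
   and on one antipodal pair (`FiveUpSet.triWOne_eq_uForm_lForm`): `triWOne P F F' G G' = U_P(F,G) + U_P(F',G') − L_P(F,G') − L_P(F',G)`.
2. **Sandwich principle** (`FiveUpSet.triW_nonneg_of_sandwichCert`): if `c > 0` and a bilinear form
   `k(A,B) = Σ_j λ_j [V_j A][B_j B]` with `λ_j ≥ 0` and MONOTONE ONE-FAMILY Boolean literals `V_j, B_j : Finset (Finset γ) → Bool` satisfies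
   `c·L_P(A,B) ≤ k(A,B) ≤ c·U_P(A,B)` for all up-sets `A, B` of `W` (`FiveUpSet.SandwichCert`), then `0 ≤ triW P F G` for EVERY index cube and all
   monotone families of up-sets — because `Σ_x ([V(F x)][B(G x)] − [V(F xᶜ)][B(G x)])` is a Kleitman gap of two up-sets of the index cube.
   Point weights `κ(u,e)` are the literals `[u ∈ A]`, `[e ∈ B]` (`FiveUpSet.SandwichPt`, `triW_nonneg_of_sandwichPt`).
3. **Equivalence with the pair-local certificate of `…TriWPairLocal`** (`FiveUpSet.pairLocalCert_iff_sandwichPt`): `PairLocalCert P c κ ↔ SandwichPt P c κ`.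
   In particular (PURE, conjectured in memo g23 §3(c) from LP evidence, now a corollary): the rows `(F,∅,G,∅)` and `(F,∅,∅,G')` of (PLC_P) already cut
   out the whole certificate polytope, and a certificate is checked on `#Up(W)²` pairs instead of `#Up(W)⁴` rows (n = 4: 28 224 instead of 7.9·10⁸).
   The LIFT criterion of `…TriWAssign` is the diagonal case `k = Σ_e c_e [e∈A][e∈B]`.
HONEST LABEL: complete proofs, std axioms; a criterion and an identity (the whole pair-local programme in closed form), not a proof of `TriWIneq`:
which `P` admit a sandwiched form `k` — conjecturally all (`PairLocalKleitman`) — stays OPEN beyond the strata already in the tree. [this work]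
-/

namespace Summit.CriticalPhenomena.PercolationContinuityZ3.Theorems

namespace FiveUpSet

open Finset

variable {β γ : Type} [DecidableEq β] [Fintype β] [DecidableEq γ] [Fintype γ]

/-! ### The two forms -/

/-- The UPPER form `U_P(A,B) = 2·#(P ∩ A ∩ B) − #(refl P ∩ A ∩ B)` (the aligned-pair part of `TRI_W`). [this work] -/
def uForm (P A B : Finset (Finset γ)) : ℤ := 2 * ((P ∩ A ∩ B).card : ℤ) - (refl P ∩ A ∩ B).card

/-- The LOWER form `L_P(A,B) = #(P ∩ refl A ∩ B) + #(P ∩ A ∩ refl B) − #(refl P ∩ A ∩ B)` (the crossed-pair part of `TRI_W`). [this work] -/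
def lForm (P A B : Finset (Finset γ)) : ℤ := ((P ∩ refl A ∩ B).card : ℤ) + (P ∩ A ∩ refl B).card - (refl P ∩ A ∩ B).card

omit [DecidableEq β] [Fintype β] in
/-- `U_P − L_P` is the sum of the two relative Kleitman gaps `Kl_{P∩B}(A) + Kl'_{P∩A}(B)`. [this work] -/
theorem uForm_sub_lForm (P A B : Finset (Finset γ)) : uForm P A B - lForm P A B = klL P A B + klR P A B := by
  unfold uForm lForm klL klR; ring

omit [DecidableEq β] [Fintype β] in
/-- For up-sets `P, A, B`: `L_P(A,B) ≤ U_P(A,B)`. [this work] -/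
theorem lForm_le_uForm {P A B : Finset (Finset γ)} (hP : IsUpperSet (P : Set (Finset γ))) (hA : IsUpperSet (A : Set (Finset γ)))
    (hB : IsUpperSet (B : Set (Finset γ))) : lForm P A B ≤ uForm P A B := by
  have h := uForm_sub_lForm P A B
  have h1 := klL_nonneg hP hA hB
  have h2 := klR_nonneg hP hA hB
  linarith

omit [DecidableEq β] [Fintype β] in
/-- `U_P(A,∅) = 0`. [this work] -/
@[simp] theorem uForm_empty_right (P A : Finset (Finset γ)) : uForm P A ∅ = 0 := by simp [uForm]

omit [DecidableEq β] [Fintype β] in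
/-- `U_P(∅,B) = 0`. [this work] -/
@[simp] theorem uForm_empty_left (P B : Finset (Finset γ)) : uForm P ∅ B = 0 := by simp [uForm]

omit [DecidableEq β] [Fintype β] in
/-- `L_P(A,∅) = 0` (the antipodal image of the empty family is empty, `LatticeFiveUpSet.refl_empty_family` of `…TriWCompression`). [this work] -/
@[simp] theorem lForm_empty_right (P A : Finset (Finset γ)) : lForm P A ∅ = 0 := by
  have h : refl (∅ : Finset (Finset γ)) = ∅ := Finset.map_empty _
  simp [lForm, h]

omit [DecidableEq β] [Fintype β] in
/-- `L_P(∅,B) = 0`. [this work] -/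
@[simp] theorem lForm_empty_left (P B : Finset (Finset γ)) : lForm P ∅ B = 0 := by
  have h : refl (∅ : Finset (Finset γ)) = ∅ := Finset.map_empty _
  simp [lForm, h]

/-! ### The master identity -/

omit [DecidableEq β] [Fintype β] in
/-- **The thin-edge functional on one antipodal pair in sandwich form**: `triWOne P F F' G G' = U_P(F,G) + U_P(F',G') − L_P(F,G') − L_P(F',G)`
(ARBITRARY families, no nestedness). [this work] -/
theorem triWOne_eq_uForm_lForm (P F F' G G' : Finset (Finset γ)) :
    LatticeFiveUpSet.triWOne (complEquiv γ) P F F' G G' = uForm P F G + uForm P F' G' - lForm P F G' - lForm P F' G := by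
  unfold LatticeFiveUpSet.triWOne uForm lForm
  simp only [image_complEquiv]
  rw [card_refl_inter_inter P F G, card_refl_inter_inter P F' G', card_refl_inter_inter P F G', card_refl_inter_inter P F' G]
  ring

/-- **Master identity**: `triW P F G = Σ_x [U_P(F x, G x) − L_P(F xᶜ, G x)]` (every index cube, every cube, no hypothesis on `P, F, G`). [this work] -/
theorem triW_eq_sum_uForm_sub_lForm (P : Finset (Finset γ)) (F G : Finset β → Finset (Finset γ)) :
    triW P F G = ∑ x : Finset β, (uForm P (F x) (G x) - lForm P (F xᶜ) (G x)) := by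
  unfold triW triWTerm uForm lForm
  -- re-index three of the sums along the antipode of the index cube
  have h1 : ∑ x : Finset β, ((P ∩ refl (F x) ∩ G xᶜ).card : ℤ) = ∑ x : Finset β, ((P ∩ refl (F xᶜ) ∩ G x).card : ℤ) :=
    Fintype.sum_equiv (complEquiv β) _ _ fun x => by simp [complEquiv, compl_compl]
  have h2 : ∑ x : Finset β, ((P ∩ F x ∩ refl (G xᶜ)).card : ℤ) = ∑ x : Finset β, ((P ∩ F xᶜ ∩ refl (G x)).card : ℤ) :=
    Fintype.sum_equiv (complEquiv β) _ _ fun x => by simp [complEquiv, compl_compl]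
  have h3 : ∑ x : Finset β, ((P ∩ refl (F x) ∩ refl (G xᶜ)).card : ℤ) = ∑ x : Finset β, ((refl P ∩ F xᶜ ∩ G x).card : ℤ) := by
    refine Fintype.sum_equiv (complEquiv β) _ _ fun x => ?_
    show ((P ∩ refl (F x) ∩ refl (G xᶜ)).card : ℤ) = ((refl P ∩ F xᶜᶜ ∩ G xᶜ).card : ℤ)
    rw [compl_compl, card_refl_inter_inter]
  have h4 : ∀ x : Finset β, ((P ∩ refl (F x) ∩ refl (G x)).card : ℤ) = ((refl P ∩ F x ∩ G x).card : ℤ) := fun x => by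
    rw [card_refl_inter_inter]
  simp only [sum_add_distrib, sum_sub_distrib, h1, h2, h3, h4]
  ring

/-! ### One-family monotone literals and the sandwich certificate -/

/-- The `0/1` value of a Boolean literal on a family, as an integer. [this work] -/
def bInd (V : Finset (Finset γ) → Bool) (A : Finset (Finset γ)) : ℤ := if V A = true then 1 else 0

/-- The value of a weighted family of literal pairs on a pair of families: `k(A,B) = Σ_j λ_j [V_j A][B_j B]`. [this work] -/
def litVal {k : ℕ} (lam : Fin k → ℕ) (V B : Fin k → (Finset (Finset γ) → Bool)) (A Bs : Finset (Finset γ)) : ℤ :=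
  ∑ j : Fin k, (lam j : ℤ) * bInd (V j) A * bInd (B j) Bs

/-- Monotonicity of a one-family Boolean literal (e.g. `[u ∈ A]`, `[u ∈ A ∨ u' ∈ A]`, `[u ∈ A ∧ u' ∈ A]`). [this work] -/
def MonoLit (V : Finset (Finset γ) → Bool) : Prop := ∀ A A' : Finset (Finset γ), A ⊆ A' → V A = true → V A' = true

/-- **The sandwich certificate property.**  For ALL up-sets `A, B` of `W`: `c·L_P(A,B) ≤ k(A,B) ≤ c·U_P(A,B)`, `k = litVal lam V B`. [this work] -/
def SandwichCert (P : Finset (Finset γ)) (c : ℕ) {k : ℕ} (lam : Fin k → ℕ) (V B : Fin k → (Finset (Finset γ) → Bool)) : Prop :=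
  ∀ A Bs : Finset (Finset γ), IsUpperSet (A : Set (Finset γ)) → IsUpperSet (Bs : Set (Finset γ)) →
    (c : ℤ) * lForm P A Bs ≤ litVal lam V B A Bs ∧ litVal lam V B A Bs ≤ (c : ℤ) * uForm P A Bs

/-- The index-cube trace of a one-family literal along a family: `{x | V (F x)}`. [this work] -/
def traceSet (V : Finset (Finset γ) → Bool) (F : Finset β → Finset (Finset γ)) : Finset (Finset β) := univ.filter fun x => V (F x) = true

omit [DecidableEq β] [Fintype γ] [DecidableEq γ] in
/-- The trace of a monotone literal along a monotone family is an up-set of the index cube. [this work] -/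
theorem isUpperSet_traceSet {V : Finset (Finset γ) → Bool} (hV : MonoLit V) {F : Finset β → Finset (Finset γ)} (hFm : Monotone F) :
    IsUpperSet (traceSet V F : Set (Finset β)) := by
  intro x y hxy hx
  simp only [traceSet, coe_filter, mem_univ, true_and, Set.mem_setOf_eq] at hx ⊢
  exact hV _ _ (hFm hxy) hx

omit [Fintype γ] [DecidableEq γ] in
/-- `Σ_x [V(F x)][B(G x)] = #(trace V F ∩ trace B G)`. [this work] -/
theorem sum_bInd_mul (V B : Finset (Finset γ) → Bool) (F G : Finset β → Finset (Finset γ)) :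
    ∑ x : Finset β, bInd V (F x) * bInd B (G x) = ((traceSet V F ∩ traceSet B G).card : ℤ) := by
  have h : ∀ x : Finset β, bInd V (F x) * bInd B (G x) = if x ∈ traceSet V F ∩ traceSet B G then (1 : ℤ) else 0 := by
    intro x; unfold bInd traceSet
    by_cases h1 : V (F x) = true <;> by_cases h2 : B (G x) = true <;> simp [h1, h2]
  rw [Finset.sum_congr rfl (fun x _ => h x), Finset.sum_boole, Finset.filter_univ_mem]

omit [Fintype γ] [DecidableEq γ] in
/-- `Σ_x [V(F xᶜ)][B(G x)] = #(refl (trace V F) ∩ trace B G)`. [this work] -/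
theorem sum_bInd_compl_mul (V B : Finset (Finset γ) → Bool) (F G : Finset β → Finset (Finset γ)) :
    ∑ x : Finset β, bInd V (F xᶜ) * bInd B (G x) = ((refl (traceSet V F) ∩ traceSet B G).card : ℤ) := by
  have h : ∀ x : Finset β, bInd V (F xᶜ) * bInd B (G x) = if x ∈ refl (traceSet V F) ∩ traceSet B G then (1 : ℤ) else 0 := by
    intro x; unfold bInd traceSet
    by_cases h1 : V (F xᶜ) = true <;> by_cases h2 : B (G x) = true <;> simp [h1, h2, mem_refl]
  rw [Finset.sum_congr rfl (fun x _ => h x), Finset.sum_boole, Finset.filter_univ_mem]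

omit [Fintype γ] [DecidableEq γ] in
/-- **Kleitman currency**: for monotone literals and monotone families, `0 ≤ Σ_x ([V(F x)][B(G x)] − [V(F xᶜ)][B(G x)])`. [this work] -/
theorem sum_bInd_sub_nonneg {V B : Finset (Finset γ) → Bool} (hV : MonoLit V) (hB : MonoLit B)
    {F G : Finset β → Finset (Finset γ)} (hFm : Monotone F) (hGm : Monotone G) :
    0 ≤ ∑ x : Finset β, (bInd V (F x) * bInd B (G x) - bInd V (F xᶜ) * bInd B (G x)) := by
  rw [sum_sub_distrib, sum_bInd_mul, sum_bInd_compl_mul]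
  have h := card_refl_inter_le (isUpperSet_traceSet hB hGm) (isUpperSet_traceSet hV hFm)
  omega

/-- **The sandwich principle.**  A sandwich certificate for `P` with `c > 0` and monotone one-family literals gives `0 ≤ triW P F G` for EVERY index
cube `Finset β` and all monotone families `F, G` of up-sets of `W`.  Proof: `c·triW = Σ_x (c·U_P(F x,G x) − c·L_P(F xᶜ,G x)) ≥ Σ_x (k(F x,G x) − k(F xᶜ,G x))
= Σ_j λ_j · (Kleitman gap of the two traces) ≥ 0`. [this work] -/
theorem triW_nonneg_of_sandwichCert {P : Finset (Finset γ)} {c k : ℕ} {lam : Fin k → ℕ} {V B : Fin k → (Finset (Finset γ) → Bool)}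
    (hc : 0 < c) (hV : ∀ j, MonoLit (V j)) (hB : ∀ j, MonoLit (B j)) (hcert : SandwichCert P c lam V B)
    (F G : Finset β → Finset (Finset γ))
    (hF : ∀ x, IsUpperSet (F x : Set (Finset γ))) (hG : ∀ x, IsUpperSet (G x : Set (Finset γ)))
    (hFm : Monotone F) (hGm : Monotone G) :
    0 ≤ triW P F G := by
  have hmain : ∑ x : Finset β, (litVal lam V B (F x) (G x) - litVal lam V B (F xᶜ) (G x))
      ≤ ∑ x : Finset β, ((c : ℤ) * uForm P (F x) (G x) - (c : ℤ) * lForm P (F xᶜ) (G x)) := by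
    refine sum_le_sum fun x _ => ?_
    have h1 := (hcert (F x) (G x) (hF x) (hG x)).2
    have h2 := (hcert (F xᶜ) (G x) (hF xᶜ) (hG x)).1
    linarith
  have hL : 0 ≤ ∑ x : Finset β, (litVal lam V B (F x) (G x) - litVal lam V B (F xᶜ) (G x)) := by
    have hrw : ∑ x : Finset β, (litVal lam V B (F x) (G x) - litVal lam V B (F xᶜ) (G x))
        = ∑ j : Fin k, (lam j : ℤ) * ∑ x : Finset β, (bInd (V j) (F x) * bInd (B j) (G x) - bInd (V j) (F xᶜ) * bInd (B j) (G x)) := by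
      unfold litVal
      calc ∑ x : Finset β, (∑ j : Fin k, (lam j : ℤ) * bInd (V j) (F x) * bInd (B j) (G x)
              - ∑ j : Fin k, (lam j : ℤ) * bInd (V j) (F xᶜ) * bInd (B j) (G x))
          = ∑ x : Finset β, ∑ j : Fin k, ((lam j : ℤ) * bInd (V j) (F x) * bInd (B j) (G x)
              - (lam j : ℤ) * bInd (V j) (F xᶜ) * bInd (B j) (G x)) := by
            refine sum_congr rfl fun x _ => ?_
            rw [← Finset.sum_sub_distrib]
        _ = ∑ j : Fin k, ∑ x : Finset β, ((lam j : ℤ) * bInd (V j) (F x) * bInd (B j) (G x)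
              - (lam j : ℤ) * bInd (V j) (F xᶜ) * bInd (B j) (G x)) := sum_comm
        _ = ∑ j : Fin k, (lam j : ℤ) * ∑ x : Finset β, (bInd (V j) (F x) * bInd (B j) (G x) - bInd (V j) (F xᶜ) * bInd (B j) (G x)) := by
            refine sum_congr rfl fun j _ => ?_
            rw [mul_sum]
            refine sum_congr rfl fun x _ => ?_
            ring
    rw [hrw]
    exact sum_nonneg fun j _ => mul_nonneg (by exact_mod_cast Nat.zero_le _) (sum_bInd_sub_nonneg (hV j) (hB j) hFm hGm)
  have hR : ∑ x : Finset β, ((c : ℤ) * uForm P (F x) (G x) - (c : ℤ) * lForm P (F xᶜ) (G x)) = (c : ℤ) * triW P F G := by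
    rw [triW_eq_sum_uForm_sub_lForm, mul_sum]
    refine sum_congr rfl fun x _ => ?_
    ring
  have h2 : 0 ≤ (c : ℤ) * triW P F G := by rw [← hR]; exact hL.trans hmain
  have hc' : (0 : ℤ) < c := by exact_mod_cast hc
  nlinarith

/-! ### Point weights: the sandwich form of `PairLocalCert` -/

/-- The value of a point weight `κ` on a pair of families: `κ(A × B) = Σ_u Σ_e κ(u,e)[u ∈ A][e ∈ B]`. [this work] -/
def ptVal (κ : Finset γ → Finset γ → ℕ) (A B : Finset (Finset γ)) : ℤ :=
  ∑ u : Finset γ, ∑ e : Finset γ, (κ u e : ℤ) * (if u ∈ A then 1 else 0) * (if e ∈ B then 1 else 0)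

/-- **The sandwich property for point weights**: for ALL up-sets `A, B`, `c·L_P(A,B) ≤ κ(A × B) ≤ c·U_P(A,B)`. [this work] -/
def SandwichPt (P : Finset (Finset γ)) (c : ℕ) (κ : Finset γ → Finset γ → ℕ) : Prop :=
  ∀ A B : Finset (Finset γ), IsUpperSet (A : Set (Finset γ)) → IsUpperSet (B : Set (Finset γ)) →
    (c : ℤ) * lForm P A B ≤ ptVal κ A B ∧ ptVal κ A B ≤ (c : ℤ) * uForm P A B

omit [DecidableEq β] [Fintype β] in
/-- `κ(A × ∅) = 0`. [this work] -/
@[simp] theorem ptVal_empty_right (κ : Finset γ → Finset γ → ℕ) (A : Finset (Finset γ)) : ptVal κ A ∅ = 0 := by simp [ptVal]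

omit [DecidableEq β] [Fintype β] in
/-- `κ(∅ × B) = 0`. [this work] -/
@[simp] theorem ptVal_empty_left (κ : Finset γ → Finset γ → ℕ) (B : Finset (Finset γ)) : ptVal κ ∅ B = 0 := by simp [ptVal]

omit [DecidableEq β] [Fintype β] in
/-- Expansion of the certificate double sum of `…TriWPairLocal` into four rectangle values:
`Σ_u Σ_e κ(u,e)·sgnDiff F F' u·sgnDiff G G' e = κ(F×G) + κ(F'×G') − κ(F×G') − κ(F'×G)`. [this work] -/
theorem sum_kappa_sgnDiff_eq (κ : Finset γ → Finset γ → ℕ) (F F' G G' : Finset (Finset γ)) :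
    ∑ u : Finset γ, ∑ e : Finset γ, (κ u e : ℤ) * sgnDiff F F' u * sgnDiff G G' e
      = ptVal κ F G + ptVal κ F' G' - ptVal κ F G' - ptVal κ F' G := by
  unfold ptVal sgnDiff
  simp only [← Finset.sum_sub_distrib, ← Finset.sum_add_distrib]
  refine sum_congr rfl fun u _ => sum_congr rfl fun e _ => ?_
  ring

omit [DecidableEq β] [Fintype β] in
/-- **`PairLocalCert ↔ SandwichPt`.**  The pair-local certificate property of `…TriWPairLocal` (an inequality for every quadruple of up-sets) is
EQUIVALENT to the sandwich property (two inequalities for every pair of up-sets).  `→`: the rows `(A,∅,B,∅)` and `(A,∅,∅,B)`; `←`: the row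
`(F,F',G,G')` is the sum of the upper inequalities at `(F,G)`, `(F',G')` and the lower ones at `(F,G')`, `(F',G)` (`triWOne_eq_uForm_lForm`). [this work] -/
theorem pairLocalCert_iff_sandwichPt (P : Finset (Finset γ)) (c : ℕ) (κ : Finset γ → Finset γ → ℕ) :
    PairLocalCert P c κ ↔ SandwichPt P c κ := by
  have hE : IsUpperSet ((∅ : Finset (Finset γ)) : Set (Finset γ)) := by rw [coe_empty]; exact isUpperSet_empty
  constructor
  · intro h A B hA hB
    have hu := h A ∅ B ∅ hA hE hB hE
    have hl := h A ∅ ∅ B hA hE hE hB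
    rw [sum_kappa_sgnDiff_eq, triWOne_eq_uForm_lForm] at hu hl
    simp only [ptVal_empty_right, ptVal_empty_left, uForm_empty_right, uForm_empty_left, lForm_empty_right, lForm_empty_left,
      add_zero, sub_zero, zero_sub, mul_neg] at hu hl
    exact ⟨by linarith, hu⟩
  · intro h F F' G G' hF hF' hG hG'
    rw [sum_kappa_sgnDiff_eq, triWOne_eq_uForm_lForm]
    have h1 := (h F G hF hG).2
    have h2 := (h F' G' hF' hG').2
    have h3 := (h F G' hF hG').1
    have h4 := (h F' G hF' hG).1
    nlinarith

/-- **The sandwich principle for point weights** (`= triW_nonneg_of_pairLocalCert` through the equivalence). [this work] -/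
theorem triW_nonneg_of_sandwichPt {P : Finset (Finset γ)} {c : ℕ} {κ : Finset γ → Finset γ → ℕ}
    (hc : 0 < c) (hcert : SandwichPt P c κ) (F G : Finset β → Finset (Finset γ))
    (hF : ∀ x, IsUpperSet (F x : Set (Finset γ))) (hG : ∀ x, IsUpperSet (G x : Set (Finset γ)))
    (hFm : Monotone F) (hGm : Monotone G) :
    0 ≤ triW P F G :=
  triW_nonneg_of_pairLocalCert hc ((pairLocalCert_iff_sandwichPt P c κ).2 hcert) F G hF hG hFm hGm

omit [DecidableEq β] [Fintype β] in
/-- **PURE** (memo g23 §3(c), conjectured from LP evidence; now a corollary): the pair-local certificate property is decided by its rows with two EMPTY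
families, `(A,∅,B,∅)` (co-nested, empty bottoms) and `(A,∅,∅,B)` (anti-nested). [this work] -/
theorem pairLocalCert_iff_empty_rows (P : Finset (Finset γ)) (c : ℕ) (κ : Finset γ → Finset γ → ℕ) :
    PairLocalCert P c κ ↔
      (∀ A B : Finset (Finset γ), IsUpperSet (A : Set (Finset γ)) → IsUpperSet (B : Set (Finset γ)) →
        (∑ u : Finset γ, ∑ e : Finset γ, (κ u e : ℤ) * sgnDiff A ∅ u * sgnDiff B ∅ e
            ≤ (c : ℤ) * LatticeFiveUpSet.triWOne (complEquiv γ) P A ∅ B ∅) ∧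
        (∑ u : Finset γ, ∑ e : Finset γ, (κ u e : ℤ) * sgnDiff A ∅ u * sgnDiff ∅ B e
            ≤ (c : ℤ) * LatticeFiveUpSet.triWOne (complEquiv γ) P A ∅ ∅ B)) := by
  have hE : IsUpperSet ((∅ : Finset (Finset γ)) : Set (Finset γ)) := by rw [coe_empty]; exact isUpperSet_empty
  constructor
  · intro h A B hA hB
    exact ⟨h A ∅ B ∅ hA hE hB hE, h A ∅ ∅ B hA hE hE hB⟩
  · intro h
    rw [pairLocalCert_iff_sandwichPt]
    intro A B hA hB
    obtain ⟨hu, hl⟩ := h A B hA hB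
    rw [sum_kappa_sgnDiff_eq, triWOne_eq_uForm_lForm] at hu hl
    simp only [ptVal_empty_right, ptVal_empty_left, uForm_empty_right, uForm_empty_left, lForm_empty_right, lForm_empty_left,
      add_zero, sub_zero, zero_sub, mul_neg] at hu hl
    exact ⟨by linarith, hu⟩

/-- The LIFT criterion of `…TriWAssign` in sandwich language: the diagonal weight `κ_φ` is a sandwich certificate (with `c = 1`). [this work] -/
theorem sandwichPt_of_assign (P : Finset (Finset γ)) (hP : IsUpperSet (P : Set (Finset γ))) (φ : Finset γ → Finset γ)
    (hφP : ∀ d ∈ refl P \ P, φ d ∈ P) (hφsub : ∀ d ∈ refl P \ P, d ⊆ φ d)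
    (hc : ∀ e ∈ P, nAssign P φ e + (if eᶜ ∈ P then 1 else 0) ≤ 2)
    (hLIFT : ∀ A B : Finset (Finset γ), IsUpperSet (A : Set (Finset γ)) → IsUpperSet (B : Set (Finset γ)) →
      ((((refl P \ P).filter (fun d => φ d ∈ A ∩ B)).card : ℤ) - ((refl P \ P).filter (fun d => d ∈ A ∩ B)).card
        ≤ klL P A B + klR P A B)) :
    SandwichPt P 1 (kapDiag P φ) :=
  (pairLocalCert_iff_sandwichPt P 1 (kapDiag P φ)).1 (pairLocalCert_of_assign P hP φ hφP hφsub hc hLIFT)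

end FiveUpSet

end Summit.CriticalPhenomena.PercolationContinuityZ3.Theorems
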